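import Mathlib.NumberTheory.DirichletCharacter.Bounds
import Mathlib.Analysis.SpecialFunctions.Complex.Circle
import HarnessLib

/-!
# rh-explicit (venture WeilGRH): «(−3/·) HAS THE HIGHEST LOWEST ZERO» — elementary glue I: the value `χ(2)` is `0` or unimodular; roots of
  unity of order `4`, `3`, `6` (moduli `5`, `7`, `9`); `χ(2) = 0` for even moduli (weil-3 gen19)

Cell `rh-explicit`, WEIL TRACK (structure seat weil-3, gen19).  Pure Mathlib facts, no analysis of `L`-functions: `chi_apply_eq_zero_or_norm_eq_one`,
`chi_two_cases_mod5` (`χ(2) ∈ {±1, ±i}` mod 5), `re_im_of_pow_three_eq_one` (`z³ = 1 ⇒ z = 1` or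
`Re z = −½ ∧ (Im z)² = ¾`), `re_im_of_pow_six_eq_one`, the per-modulus facts `chi_neg_one_mod5` (`χ(−1) = χ(2)²`), `pow_chi_two_mod7/9` (`χ(2)³ = 1` mod 7,
`χ(2)⁶ = 1` mod 9, `χ(−1) = χ(2)³` mod 9), `chi_two_eq_zero_of_even_modulus` (`q ∈ {4,6,8,10}`).  Part II
(`ChampionCircle`) is the cover of the unit circle by the 22 value boxes.  RH/GRH-free; no definitions; standard axioms.
-/

set_option autoImplicit false

namespace Summit.Ventures.WeilGRH.Christoffel

open Complex

/-! ## `χ(2)` is `0` or unimodular -/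

/-- A Dirichlet character value is `0` or has norm `1`. -/
theorem chi_apply_eq_zero_or_norm_eq_one {q : ℕ} (χ : DirichletCharacter ℂ q) (x : ZMod q) : χ x = 0 ∨ ‖χ x‖ = 1 := by
  by_cases hx : IsUnit x
  · exact Or.inr (by simpa using χ.unit_norm_eq_one hx.unit)
  · exact Or.inl (χ.map_nonunit hx)

/-! ## Roots of unity of order `4`, `3`, `6` -/

/-- mod `5`: `χ(2) ∈ {1, −1, i, −i}` (from `χ(2)⁴ = χ(16) = 1`). -/
theorem chi_two_cases_mod5 (χ : DirichletCharacter ℂ 5) :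
    χ (2 : ZMod 5) = 1 ∨ χ (2 : ZMod 5) = -1 ∨ χ (2 : ZMod 5) = I ∨ χ (2 : ZMod 5) = -I := by
  have hz : χ (2 : ZMod 5) ^ 4 = 1 := by rw [← map_pow, show ((2 : ZMod 5) ^ 4) = 1 by decide, map_one]
  set z := χ (2 : ZMod 5)
  have h : (z ^ 2 - 1) * (z ^ 2 + 1) = 0 := by linear_combination hz
  rcases mul_eq_zero.1 h with h1 | h1
  · have : z ^ 2 = 1 := by linear_combination h1
    rcases sq_eq_one_iff.1 this with h2 | h2
    · exact Or.inl h2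
    · exact Or.inr (Or.inl h2)
  · have h3 : (z - I) * (z + I) = 0 := by
      have e : (z - I) * (z + I) = z ^ 2 - I ^ 2 := by ring
      rw [e, Complex.I_sq]; linear_combination h1
    rcases mul_eq_zero.1 h3 with h4 | h4
    · exact Or.inr (Or.inr (Or.inl (by linear_combination h4)))
    · exact Or.inr (Or.inr (Or.inr (by linear_combination h4)))

/-- `z³ = 1 ⇒ z = 1` or `Re z = −½ ∧ (Im z)² = ¾`. -/
theorem re_im_of_pow_three_eq_one {z : ℂ} (hz : z ^ 3 = 1) : z = 1 ∨ (z.re = -1 / 2 ∧ z.im ^ 2 = 3 / 4) := by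
  have h : (z - 1) * (z ^ 2 + z + 1) = 0 := by linear_combination hz
  rcases mul_eq_zero.1 h with h1 | h1
  · exact Or.inl (by linear_combination h1)
  · right
    have hre := congrArg Complex.re h1
    have him := congrArg Complex.im h1
    simp only [Complex.add_re, Complex.add_im, Complex.one_re, Complex.one_im, Complex.zero_re, Complex.zero_im, sq,
      Complex.mul_re, Complex.mul_im] at hre him
    have him' : z.im * (2 * z.re + 1) = 0 := by linear_combination him
    rcases mul_eq_zero.1 him' with hy | hx
    · exfalso
      rw [hy] at hre
      nlinarith [sq_nonneg (z.re + 1 / 2)]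
    · have hx' : z.re = -1 / 2 := by linarith
      refine ⟨hx', ?_⟩
      rw [hx'] at hre
      nlinarith [hre]

/-- `z⁶ = 1 ⇒ z³ = 1` or `(−z)³ = 1`; in the second case `z = −1` or `Re z = ½ ∧ (Im z)² = ¾`. -/
theorem re_im_of_pow_six_eq_one {z : ℂ} (hz : z ^ 6 = 1) :
    z = 1 ∨ (z.re = -1 / 2 ∧ z.im ^ 2 = 3 / 4) ∨ z = -1 ∨ (z.re = 1 / 2 ∧ z.im ^ 2 = 3 / 4) := by
  have h : (z ^ 3 - 1) * (z ^ 3 + 1) = 0 := by linear_combination hz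
  rcases mul_eq_zero.1 h with h1 | h1
  · rcases re_im_of_pow_three_eq_one (by linear_combination h1 : z ^ 3 = 1) with h2 | h2
    · exact Or.inl h2
    · exact Or.inr (Or.inl h2)
  · have h3 : (-z) ^ 3 = 1 := by linear_combination -h1
    rcases re_im_of_pow_three_eq_one h3 with h2 | h2
    · exact Or.inr (Or.inr (Or.inl (by linear_combination -h2)))
    · refine Or.inr (Or.inr (Or.inr ⟨?_, ?_⟩))
      · have := h2.1; simp only [Complex.neg_re] at this; linarith
      · have := h2.2; simp only [Complex.neg_im, neg_sq] at this; exact this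

/-! ## Per-modulus facts -/

/-- mod `5`: `χ(−1) = χ(2)²`. -/
theorem chi_neg_one_mod5 (χ : DirichletCharacter ℂ 5) : χ (-1) = χ (2 : ZMod 5) ^ 2 := by
  rw [← map_pow, show ((2 : ZMod 5) ^ 2) = -1 by decide]

/-- mod `7`: `χ(2)³ = 1`. -/
theorem pow_chi_two_mod7 (χ : DirichletCharacter ℂ 7) : χ (2 : ZMod 7) ^ 3 = 1 := by
  rw [← map_pow, show ((2 : ZMod 7) ^ 3) = 1 by decide, map_one]

/-- mod `9`: `χ(2)⁶ = 1` and `χ(−1) = χ(2)³`. -/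
theorem pow_chi_two_mod9 (χ : DirichletCharacter ℂ 9) : χ (2 : ZMod 9) ^ 6 = 1 ∧ χ (-1) = χ (2 : ZMod 9) ^ 3 := by
  constructor
  · rw [← map_pow, show ((2 : ZMod 9) ^ 6) = 1 by decide, map_one]
  · rw [← map_pow, show ((2 : ZMod 9) ^ 3) = -1 by decide]

/-- For an even modulus among `4, 6, 8, 10`, `χ(2) = 0`. -/
theorem chi_two_eq_zero_of_even_modulus {q : ℕ} (hq : q = 4 ∨ q = 6 ∨ q = 8 ∨ q = 10) (χ : DirichletCharacter ℂ q) :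
    χ (2 : ZMod q) = 0 := by
  apply χ.map_nonunit
  intro hu
  have h2 : (2 : ZMod q) = ((2 : ℕ) : ZMod q) := by norm_cast
  rw [h2, ZMod.isUnit_iff_coprime] at hu
  rcases hq with rfl | rfl | rfl | rfl <;> exact absurd hu (by decide)

end Summit.Ventures.WeilGRH.Christoffel
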